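import Literature.NumberTheory.Automorphic.SatakeParametersGLXiDegree
import Literature.NumberTheory.Automorphic.SatakeParametersGLTemperedProofs
import Literature.NumberTheory.Automorphic.GodementJacquetLocalConvergenceProofs
import Mathlib.MeasureTheory.Integral.Lebesgue.Countable
import HarnessLib

/-!
# Unitary Satake parameters ⇒ tempered: discharge of `isTempered_iff_forall_norm_eq_one`

Topic `NumberTheory/Automorphic`; theorems only.  This file proves the named fact
`Literature.NumberTheory.Automorphic.isTempered_iff_forall_norm_eq_one` of `SatakeParametersGL`
(Macdonald (1971); Cartier, Corvallis (1979), §IV.5; Borel, Corvallis (1979), §10.4; Getz–Hahn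
(2024), Exercise 8.11): *an irreducible admissible representation `ρ` of `GL_n(F)`, `F` a
non-archimedean local field, with Satake parameters `α` (unitary normalisation of
`IsSatakeParameter`) is tempered — `Representation.IsTempered`, every smooth matrix coefficient
dominated by the pull-back of an `L^{2+ε}(G/Z)` function for every `ε > 0` — iff `|α_j| = 1` for
all `j`*.  The direction `→` and the reduction to `←` are in `SatakeParametersGLTemperedProofs`
(`isTempered_iff_forall_norm_eq_one_of_converse`); here is `←`
(`isTempered_of_forall_norm_eq_one`) and the discharge `isTempered_iff_forall_norm_eq_one_holds`.

## The proof of `←`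

Let `K = GL_n(𝒪)`, `Q = √q`, `v ∈ V^K` the spherical eigenvector, `φ₀ ∈ Ṽ^K` with `φ₀(v) ≠ 0`,
and `Γb(g) = Ξ-sum(g) / #(KgK/K)` (`xiSum`/degree; `SatakeParametersGLXiRecursion`), a bi-`K`-
and centrally invariant function on `G` (`xiBound`).

1. *Zonal bound* (`norm_apply_le_mul_xiBound`): `‖φ₀(ρ(g) v)‖ ≤ ‖φ₀ v‖ Γb(g)`: for `g` integral
   this is `#(KgK/K) φ₀(ρ(g)v) = 𝒮(T_g)(z) φ₀(v)` at the point `z = q^{(n-1)/2} α`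
   (`SphericalHeckeEigenvaluesGL`, seat 0 of this fact) with `|𝒮(T_g)(z)| ≤ 𝒮(T_g)(z₀) = Ξ-sum(g)`
   for unitary `α` (`SatakeParametersGLXiDegree`); general `g` by a central power of `ϖ`.
2. *All coefficients* (`exists_norm_matrixCoeff_le_mul_xiBound`): `φ`, `w` are finite
   combinations of translates of `φ₀`, `v` (irreducibility of `V` and `Ṽ`), so
   `c_{φ,w}(g) = ∑ a_i b_j φ₀(ρ(h_i⁻¹ g g_j) v)`, and two-sided translates of `Γb` are dominated
   by multiples of `Γb` (submultiplicativity, `xiSum_div_card_mul_mul_le`): `‖c_{φ,w}‖ ≤ C Γb`.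
3. *Integrability* (`memLp_xiBoundQuot`): `Γb` descends to a continuous function on `G/Z`;
   by the Cartan decomposition `G/Z` is covered by the images of `K ϖ^λ K`, `λ` antitone with
   `λ_{n-1} = 0`, of measure `≤ #(Kϖ^λK/K) μ(KZ/Z)`, on which
   `Γb = Ξ-sum(ϖ^λ)/#(Kϖ^λK/K) ≤ (|λ|+1)^{n²} Q^{2⟨ρ,λ⟩} / Q^{4⟨ρ,λ⟩}`
   (Harish-Chandra estimate `xiSum_piPowGL_le` and degree bound
   `sqrtResidueCard_zpow_le_card_orbit`), so
   `∫ Γb^p ≤ μ(KZ/Z) ∑_λ (|λ|+1)^{n²p} Q^{(2-p)·2⟨ρ,λ⟩} < ∞` for `p > 2`, as `2⟨ρ,λ⟩ ≥ |λ|`.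

## References

* P. Cartier, *Representations of 𝔭-adic groups: a survey*, Proc. Sympos. Pure Math. 33 (1979),
  part 1, §IV [CartierCorvallis1979].
* I. G. Macdonald, *Spherical functions on a group of 𝔭-adic type* (1971); *Symmetric functions
  and Hall polynomials* (1995), Ch. V [Macdonald1995].
* J. R. Getz, H. Hahn, *An introduction to automorphic representations* (2024), Exercise 8.11
  [GetzHahn2024].
-/

noncomputable section

open scoped Pointwise MatrixGroups ENNReal
open MulAction ValuativeRel Matrix Finset MonoidAlgebra Representation MeasureTheory

universe u

namespace Literature.NumberTheory.Automorphic

section LocalField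

variable {n : ℕ} {F : Type u} [Field F] [ValuativeRel F] [TopologicalSpace F]
  [IsNonarchimedeanLocalField F] {ϖ : F} (hϖ : IsUniformizingElement ϖ)

/-! ### The function `Γb = Ξ-sum / deg` -/

/-- **The dominating function** `Γb(g) = Ξ-sum(g) / #(KgK/K)`: the quotient of the
Harish-Chandra sum `∑_{c ∈ KgK/K} Q^{-2⟨ρ, e(c)⟩}` by the degree, i.e. Harish-Chandra's `Ξ(g)`
up to the unitary central twist (`= ∫_K δ_B^{1/2}(a(kg)) dk` on `g` of determinant a unit).
[folklore] -/
def xiBound (g : GL (Fin n) F) : ℝ :=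
  xiSum hϖ (sqrtResidueCard F) g / (finite_orbit_quotient (glInt n F) g).toFinset.card

/-- `Γb ≥ 0`. [folklore] -/
theorem xiBound_nonneg (g : GL (Fin n) F) : 0 ≤ xiBound hϖ g :=
  div_nonneg (xiSum_nonneg hϖ sqrtResidueCard_pos.le g) (Nat.cast_nonneg _)

/-- The degree `#(KgK/K)` is positive. [folklore] -/
theorem card_orbit_pos (g : GL (Fin n) F) :
    0 < ((finite_orbit_quotient (glInt n F) g).toFinset.card : ℝ) := by
  exact_mod_cast Finset.card_pos.2 ⟨(g : GL (Fin n) F ⧸ glInt n F),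
    (Set.Finite.mem_toFinset _).2 (MulAction.mem_orbit_self _)⟩

omit [TopologicalSpace F] [IsNonarchimedeanLocalField F] in
/-- Finite sets of the same orbit coincide. [folklore] -/
theorem toFinset_orbit_eq_of_mem_orbit {g g' : GL (Fin n) F}
    (h : (g' : GL (Fin n) F ⧸ glInt n F) ∈ orbit (glInt n F) (g : GL (Fin n) F ⧸ glInt n F))
    (hfin : (orbit (glInt n F) (g : GL (Fin n) F ⧸ glInt n F)).Finite)
    (hfin' : (orbit (glInt n F) (g' : GL (Fin n) F ⧸ glInt n F)).Finite) :
    hfin'.toFinset = hfin.toFinset := by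
  ext c
  rw [Set.Finite.mem_toFinset, Set.Finite.mem_toFinset, MulAction.orbit_eq_iff.2 h]

/-- `Γb(k₁ g k₂) = Γb(g)`. [folklore] -/
theorem xiBound_glInt_mul_mul_glInt {g k₁ k₂ : GL (Fin n) F} (hk₁ : k₁ ∈ glInt n F)
    (hk₂ : k₂ ∈ glInt n F) : xiBound hϖ (k₁ * g * k₂) = xiBound hϖ g := by
  unfold xiBound
  rw [xiSum_glInt_mul_mul_glInt hϖ _ hk₁ hk₂, toFinset_orbit_eq_of_mem_orbit
    ((heckeAlgebra.coe_mem_orbit_coe_iff _ g _).2 ⟨k₁, hk₁, k₂, hk₂, rfl⟩)]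

/-- **Central invariance**: `Γb(ϖ^N g) = Γb(g)` for the central element `ϖ^N · 1`. [folklore] -/
theorem xiBound_zpowDiagGL_const_mul (N : ℤ) (g : GL (Fin n) F) :
    xiBound hϖ (zpowDiagGL hϖ.ne_zero (fun _ : Fin n => N) * g) = xiBound hϖ g := by
  set z : GL (Fin n) F := zpowDiagGL hϖ.ne_zero (fun _ : Fin n => N) with hz
  have hzc : ∀ x : GL (Fin n) F, x * z = z * x := fun x => (mul_zpowDiagGL_const_comm hϖ.ne_zero N x)
  have horb := heckeAlgebra.orbit_mk_central_mul (glInt n F) hzc g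
  -- the translation `c ↦ z • c` is a bijection of the orbits preserving the weights
  have hbij : Set.BijOn (fun c : GL (Fin n) F ⧸ glInt n F => z • c)
      (orbit (glInt n F) (g : GL (Fin n) F ⧸ glInt n F))
      (orbit (glInt n F) ((z * g : GL (Fin n) F) : GL (Fin n) F ⧸ glInt n F)) := by
    rw [horb]
    exact Set.InjOn.bijOn_image (MulAction.injective z).injOn
  have hw : ∀ c : GL (Fin n) F ⧸ glInt n F, xiWeight (sqrtResidueCard F) (iwasawaExp hϖ (z • c).out) =
      xiWeight (sqrtResidueCard F) (iwasawaExp hϖ c.out) := by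
    intro c
    have hc : ((z * c.out : GL (Fin n) F) : GL (Fin n) F ⧸ glInt n F) = z • c := by
      conv_rhs => rw [← QuotientGroup.out_eq' c]
      rw [MulAction.Quotient.smul_mk, smul_eq_mul]
    have he : iwasawaExp hϖ (z • c).out = iwasawaExp hϖ (z * c.out) :=
      iwasawaExp_eq_of_coe_eq hϖ (by rw [QuotientGroup.out_eq', hc])
    rw [he, hz, ← one_mul (zpowDiagGL hϖ.ne_zero (fun _ : Fin n => N)),
      iwasawaExp_unipotent_mul_zpowDiagGL_mul hϖ (Subgroup.one_mem _), add_comm, xiWeight_add_const]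
  have hi : ∀ c ∈ (finite_orbit_quotient (glInt n F) g).toFinset,
      z • c ∈ (finite_orbit_quotient (glInt n F) (z * g)).toFinset := by
    intro c hc
    rw [Set.Finite.mem_toFinset] at hc ⊢
    rw [horb]
    exact ⟨c, hc, rfl⟩
  have hj : ∀ c ∈ (finite_orbit_quotient (glInt n F) (z * g)).toFinset,
      z⁻¹ • c ∈ (finite_orbit_quotient (glInt n F) g).toFinset := by
    intro c hc
    rw [Set.Finite.mem_toFinset] at hc ⊢
    rw [horb] at hc
    obtain ⟨c', hc', rfl⟩ := hc
    rwa [inv_smul_smul]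
  unfold xiBound
  congr 1
  · rw [xiSum_eq_sum hϖ _ (finite_orbit_quotient (glInt n F) (z * g)),
      xiSum_eq_sum hϖ _ (finite_orbit_quotient (glInt n F) g)]
    exact (Finset.sum_nbij' (fun c => z • c) (fun c => z⁻¹ • c) hi hj (fun c _ => inv_smul_smul z c)
      (fun c _ => smul_inv_smul z c) (fun c _ => (hw c).symm)).symm
  · congr 1
    exact (Finset.card_nbij' (fun c => z • c) (fun c => z⁻¹ • c) hi hj (fun c _ => inv_smul_smul z c)
      (fun c _ => smul_inv_smul z c)).symm

/-- **Central elements are `ϖ^N · k` with `k ∈ K`** (they are scalars `c · 1`, `c = ϖ^N w`,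
`|w| = 1`). [folklore] -/
theorem exists_eq_zpowDiagGL_const_mul_of_mem_center {z : GL (Fin n) F}
    (hz : z ∈ Subgroup.center (GL (Fin n) F)) :
    ∃ (N : ℤ) (k : GL (Fin n) F), k ∈ glInt n F ∧ k ∈ Subgroup.center (GL (Fin n) F) ∧
      z = zpowDiagGL hϖ.ne_zero (fun _ : Fin n => N) * k := by
  rw [Matrix.GeneralLinearGroup.center_eq_range_scalar] at hz
  obtain ⟨c, rfl⟩ := hz
  obtain ⟨N, w, hw, hcw⟩ := exists_eq_zpow_mul_of_ne_zero hϖ c.ne_zero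
  have hw0 : w ≠ 0 := by rintro rfl; rw [map_zero] at hw; exact zero_ne_one hw
  refine ⟨N, Matrix.GeneralLinearGroup.scalar (Fin n) (Units.mk0 w hw0), ?_, ?_, ?_⟩
  · rw [← heckeDiag_self_eq_scalar]
    exact heckeDiag_mem_glInt (by rw [Units.val_mk0]; exact hw) n
  · rw [Matrix.GeneralLinearGroup.center_eq_range_scalar]; exact ⟨_, rfl⟩
  · refine Units.ext ?_
    rw [Units.val_mul, Matrix.GeneralLinearGroup.coe_scalar, Matrix.GeneralLinearGroup.coe_scalar,
      coe_zpowDiagGL, Units.val_mk0, hcw, Matrix.scalar_apply, Matrix.scalar_apply,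
      Matrix.diagonal_mul_diagonal]

/-- **`Γb` is invariant under the centre**: `Γb(g z) = Γb(g)` for `z ∈ Z(GL_n(F))`. [folklore] -/
theorem xiBound_mul_of_mem_center (g : GL (Fin n) F) {z : GL (Fin n) F}
    (hz : z ∈ Subgroup.center (GL (Fin n) F)) : xiBound hϖ (g * z) = xiBound hϖ g := by
  obtain ⟨N, k, hk, hkc, rfl⟩ := exists_eq_zpowDiagGL_const_mul_of_mem_center hϖ hz
  rw [← mul_assoc, mul_zpowDiagGL_const_comm hϖ.ne_zero N g, mul_assoc,
    xiBound_zpowDiagGL_const_mul, show g * k = 1 * g * k by rw [one_mul],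
    xiBound_glInt_mul_mul_glInt hϖ (Subgroup.one_mem _) hk]

/-- `Γb` is a function on `G/Z`: `g Z = g' Z ⇒ Γb(g) = Γb(g')`. [folklore] -/
theorem xiBound_eq_of_coe_eq {g g' : GL (Fin n) F}
    (h : (g : GL (Fin n) F ⧸ Subgroup.center (GL (Fin n) F)) = g') : xiBound hϖ g = xiBound hϖ g' := by
  rw [QuotientGroup.eq] at h
  have : g' = g * (g⁻¹ * g') := by rw [mul_inv_cancel_left]
  rw [this, xiBound_mul_of_mem_center hϖ g h]

/-! ### The zonal bound -/

/-- **`R^m Ξ'(g) = Ξ-sum(g)`** on `Δ_m`: the orbit sum `orbitTwistSum` of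
`SphericalHeckeEigenvaluesGL` (weights `q^{-⟨ν,e⟩}`) times `R^m = Q^{(n-1)m}` is the
Harish-Chandra sum (weights `Q^{-2⟨ρ,e⟩}`), since `∑ e_i = m` on `Δ_m`. [folklore] -/
theorem pow_mul_orbitTwistSum_eq_xiSum {g : GL (Fin n) F} {m : ℕ} (hg : g ∈ glIntDet n ϖ m) :
    (sqrtResidueCard F ^ (n - 1)) ^ m * orbitTwistSum hϖ g = xiSum hϖ (sqrtResidueCard F) g := by
  have hQ : 0 < sqrtResidueCard F := sqrtResidueCard_pos
  rw [orbitTwistSum, Finset.mul_sum, xiSum_eq_sum hϖ _ (finite_orbit_quotient (glInt n F) g)]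
  refine Finset.sum_congr rfl fun γ hγ => ?_
  rw [Set.Finite.mem_toFinset] at hγ
  have hγm : γ.out ∈ glIntDet n ϖ m := by
    obtain ⟨κ, rfl⟩ := MulAction.mem_orbit_iff.1 hγ
    rw [smul_out_mem_glIntDet_iff, mk_out_mem_glIntDet_iff]
    exact hg
  have hsum := sum_iwasawaExp_eq_of_mem_glIntDet hϖ hγm
  have e1 : sqrtResidueCard F ^ (((n - 1 : ℕ) : ℤ) * (m : ℤ)) = (sqrtResidueCard F ^ (n - 1)) ^ m := by
    rw [_root_.zpow_mul, zpow_natCast, zpow_natCast]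
  rw [← e1, card_zpow_eq_sqrtResidueCard_zpow, ← zpow_add₀ hQ.ne', xiWeight,
    twoRho_eq_two_mul_satakeTwistExp_sub, hsum]
  congr 1
  rcases Nat.eq_zero_or_pos n with hn | hn
  · subst hn
    have h0 : (m : ℤ) = 0 := by
      have h := hsum
      rw [Finset.univ_eq_empty, Finset.sum_empty] at h
      exact h.symm
    rw [h0]
    simp
  · rw [Nat.cast_sub hn]
    push_cast
    ring

variable {V : Type*} [AddCommGroup V] [Module ℂ V] (ρ : Representation ℂ (GL (Fin n) F) V)

/-- **The zonal bound.** For a `K`-invariant linear form `φ₀`, a `K`-fixed common eigenvector `v`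
of the `T_r` with Satake point `z` of modulus `‖z_i‖ = Q^{n-1}` (unitary parameters), on which
the centre `ϖ · 1` acts by a scalar of norm `1`:  `‖φ₀(ρ(g) v)‖ ≤ ‖φ₀ v‖ Γb(g)` for all `g`.
[folklore] -/
theorem norm_apply_le_mul_xiBound {φ₀ : Module.Dual ℂ V}
    (hφ₀ : ∀ k ∈ glInt n F, ∀ w : V, φ₀ (ρ k w) = φ₀ w) {v : V} (hv : v ∈ ρ.fixedPoints (glInt n F))
    {z : Fin n → ℂˣ}
    (hT : ∀ r, 1 ≤ r → r ≤ n →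
      heckeOperator ρ (glInt n F) (heckeDiag n (Units.mk0 ϖ hϖ.ne_zero) r) v =
        ((((Nat.card 𝓀[F] : ℂ) ^ (r * (r - 1) / 2))⁻¹ *
          MvPolynomial.eval (fun i => (z i : ℂ)) (MvPolynomial.esymm (Fin n) ℂ r)) • v))
    (hz : ∀ i, ‖(z i : ℂ)‖ = sqrtResidueCard F ^ (n - 1))
    {P : ℂ} (hP : ‖P‖ = 1) (hPv : ρ (heckeDiag n (Units.mk0 ϖ hϖ.ne_zero) n) v = P • v)
    (g : GL (Fin n) F) : ‖φ₀ (ρ g v)‖ ≤ ‖φ₀ v‖ * xiBound hϖ g := by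
  have hQ : 0 < sqrtResidueCard F := sqrtResidueCard_pos
  -- scale `g` into the integral matrices by a central power of `ϖ`
  obtain ⟨N, hN⟩ := exists_zpowDiagGL_mul_isIntegralMatrix hϖ g
  set g₀ : GL (Fin n) F := zpowDiagGL hϖ.ne_zero (fun _ : Fin n => (N : ℤ)) * g with hg₀
  have hdet0 : ((g₀ : GL (Fin n) F) : Matrix (Fin n) (Fin n) F).det ≠ 0 :=
    Matrix.GeneralLinearGroup.det_ne_zero g₀
  obtain ⟨m, w, hw, hmw⟩ := exists_eq_pow_mul_of_mem_integer hϖ hN.det_mem hdet0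
  have hg₀m : g₀ ∈ glIntDet n ϖ m := ⟨hN, by rw [hmw, map_mul, map_pow, hw, mul_one]⟩
  -- the bound on `Δ_m`
  have hR : 0 < sqrtResidueCard F ^ (n - 1) := pow_pos hQ _
  have h := card_orbit_mul_norm_apply_le ρ hϖ hφ₀ hv hT hR hz hg₀m
  rw [pow_mul_orbitTwistSum_eq_xiSum hϖ hg₀m] at h
  -- `φ₀(ρ(g₀) v) = P^N φ₀(ρ(g) v)`
  have hzN : zpowDiagGL hϖ.ne_zero (fun _ : Fin n => (N : ℤ)) =
      (heckeDiag n (Units.mk0 ϖ hϖ.ne_zero) n) ^ N := (SatakeGL.heckeDiag_self_pow_eq_zpowDiagGL hϖ N).symm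
  have hval : φ₀ (ρ g₀ v) = P ^ N * φ₀ (ρ g v) := by
    rw [hg₀, ← mul_zpowDiagGL_const_comm hϖ.ne_zero (N : ℤ) g, hzN, map_mul, Module.End.mul_apply,
      apply_pow_eq_pow_smul ρ hPv N, map_smul, map_smul, smul_eq_mul]
  have hnorm : ‖φ₀ (ρ g₀ v)‖ = ‖φ₀ (ρ g v)‖ := by rw [hval, norm_mul, norm_pow, hP, one_pow, one_mul]
  -- `Γb(g₀) = Γb(g)`
  have hb : xiBound hϖ g₀ = xiBound hϖ g := xiBound_zpowDiagGL_const_mul hϖ (N : ℤ) g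
  rw [← hnorm, ← hb, xiBound, mul_div_assoc', le_div_iff₀ (card_orbit_pos g₀), mul_comm]
  exact h

/-! ### All matrix coefficients -/

/-- **Every smooth matrix coefficient is dominated by a multiple of `Γb`.** For an irreducible
admissible `ρ`, a smooth `K`-invariant linear form `φ₀` and `v ≠ 0` with the zonal bound
`‖φ₀(ρ(g) v)‖ ≤ ‖φ₀ v‖ Γb(g)`, every coefficient `c_{φ,w}`, `φ ∈ Ṽ`, satisfies
`‖c_{φ,w}(g)‖ ≤ C Γb(g)`: `w` and `φ` are finite combinations of translates of `v` and `φ₀`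
(`V` and `Ṽ` are irreducible, `isIrreducible_contragredient_holds`), so
`c_{φ,w}(g) = ∑ a_i b_j φ₀(ρ(h_i⁻¹ g g_j) v)`, and `Γb(h⁻¹ g g') ≤ C(h, g') Γb(g)`
(`xiSum_div_card_mul_mul_le`). [folklore] -/
theorem exists_norm_matrixCoeff_le_mul_xiBound [ρ.IsIrreducible] (hadm : ρ.IsAdmissible)
    {φ₀ : Module.Dual ℂ V} (hφ₀c : φ₀ ∈ ρ.contragredient) {v : V} (hv0 : v ≠ 0)
    (hzonal : ∀ g, ‖φ₀ (ρ g v)‖ ≤ ‖φ₀ v‖ * xiBound hϖ g) (hφ₀v : φ₀ v ≠ 0)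
    {φ : Module.Dual ℂ V} (hφ : φ ∈ ρ.contragredient) (w : V) :
    ∃ C : ℝ, 0 ≤ C ∧ ∀ g, ‖ρ.matrixCoeff φ w g‖ ≤ C * xiBound hϖ g := by
  -- cyclic expansions of `w` and `φ`
  obtain ⟨c, hc⟩ := exists_finsupp_sum_smul_apply_eq ρ hv0 w
  haveI : T2Space F := t2Space_of_isNonarchimedeanLocalField
  haveI : NonarchimedeanGroup (GL (Fin n) F) := nonarchimedeanGroup_gl F n
  haveI : LocallyCompactSpace (Matrix (Fin n) (Fin n) F) :=
    inferInstanceAs (LocallyCompactSpace (Fin n → Fin n → F))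
  haveI : LocallyCompactSpace (GL (Fin n) F) := inferInstance
  haveI hirr : ρ.contragredientRep.IsIrreducible :=
    Representation.isIrreducible_contragredient_holds ρ hadm
  have hΦ₀0 : (⟨φ₀, hφ₀c⟩ : ρ.Contragredient) ≠ 0 := fun h => by
    have : φ₀ = 0 := congrArg (Representation.Contragredient.subtype ρ) h
    exact hφ₀v (by rw [this, LinearMap.zero_apply])
  obtain ⟨d, hd⟩ := exists_finsupp_sum_smul_apply_eq ρ.contragredientRep hΦ₀0 ⟨φ, hφ⟩
  have hw : w = ∑ g ∈ c.support, c g • ρ g v := by rw [← hc]; rfl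
  have hφ' : φ = ∑ h ∈ d.support, d h • ρ.dual h φ₀ := by
    have := congrArg (Representation.Contragredient.subtype ρ) hd
    rw [Finsupp.sum, map_sum] at this
    rw [← show Representation.Contragredient.subtype ρ ⟨φ, hφ⟩ = φ from rfl, ← this]
    refine Finset.sum_congr rfl fun h _ => ?_
    rw [map_smul, Representation.subtype_contragredientRep_apply]
    rfl
  have key : ∀ x : GL (Fin n) F, φ (ρ x w) =
      ∑ h ∈ d.support, ∑ g ∈ c.support, d h * c g * φ₀ (ρ (h⁻¹ * x * g) v) := by
    intro x
    rw [hw, hφ', LinearMap.sum_apply]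
    refine Finset.sum_congr rfl fun h _ => ?_
    rw [LinearMap.smul_apply, map_sum, map_sum, smul_eq_mul, Finset.mul_sum]
    refine Finset.sum_congr rfl fun g _ => ?_
    rw [map_smul, map_smul, smul_eq_mul]
    simp only [Representation.dual_apply, Module.Dual.transpose_apply, LinearMap.comp_apply,
      map_mul, Module.End.mul_apply]
    ring
  -- the constants of the translates
  set Cst : GL (Fin n) F → GL (Fin n) F → ℝ := fun h g =>
    xiSum hϖ (sqrtResidueCard F) h⁻¹ * xiSum hϖ (sqrtResidueCard F) g *
      ((finite_orbit_quotient (glInt n F) h⁻¹⁻¹).toFinset.card *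
        (finite_orbit_quotient (glInt n F) g⁻¹).toFinset.card) with hCst
  have hCst0 : ∀ h g, 0 ≤ Cst h g := fun h g =>
    mul_nonneg (mul_nonneg (xiSum_nonneg hϖ sqrtResidueCard_pos.le _)
      (xiSum_nonneg hϖ sqrtResidueCard_pos.le _)) (by positivity)
  have htrans : ∀ h g x : GL (Fin n) F, xiBound hϖ (h⁻¹ * x * g) ≤ Cst h g * xiBound hϖ x :=
    fun h g x => xiSum_div_card_mul_mul_le hϖ h⁻¹ x g
  refine ⟨∑ h ∈ d.support, ∑ g ∈ c.support, ‖d h‖ * ‖c g‖ * (‖φ₀ v‖ * Cst h g),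
    Finset.sum_nonneg fun h _ => Finset.sum_nonneg fun g _ =>
      mul_nonneg (mul_nonneg (norm_nonneg _) (norm_nonneg _)) (mul_nonneg (norm_nonneg _) (hCst0 h g)),
    fun x => ?_⟩
  rw [Representation.matrixCoeff_apply, key x, Finset.sum_mul]
  refine (norm_sum_le _ _).trans (Finset.sum_le_sum fun h _ => ?_)
  rw [Finset.sum_mul]
  refine (norm_sum_le _ _).trans (Finset.sum_le_sum fun g _ => ?_)
  rw [norm_mul, norm_mul]
  calc ‖d h‖ * ‖c g‖ * ‖φ₀ (ρ (h⁻¹ * x * g) v)‖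
      ≤ ‖d h‖ * ‖c g‖ * (‖φ₀ v‖ * xiBound hϖ (h⁻¹ * x * g)) :=
        mul_le_mul_of_nonneg_left (hzonal _) (by positivity)
    _ ≤ ‖d h‖ * ‖c g‖ * (‖φ₀ v‖ * (Cst h g * xiBound hϖ x)) :=
        mul_le_mul_of_nonneg_left (mul_le_mul_of_nonneg_left (htrans h g x) (norm_nonneg _))
          (mul_nonneg (norm_nonneg _) (norm_nonneg _))
    _ = ‖d h‖ * ‖c g‖ * (‖φ₀ v‖ * Cst h g) * xiBound hϖ x := by ring

/-! ### `Γb` on `G / Z` -/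

/-- `Γb` as a function on `GL_n(F) / Z` (through `Quotient.out`; well defined by
`xiBound_eq_of_coe_eq`). [folklore] -/
def xiBoundQuot (q : GL (Fin n) F ⧸ Subgroup.center (GL (Fin n) F)) : ℝ := xiBound hϖ q.out

/-- `xiBoundQuot (g Z) = Γb(g)`. [folklore] -/
theorem xiBoundQuot_mk (g : GL (Fin n) F) :
    xiBoundQuot hϖ (g : GL (Fin n) F ⧸ Subgroup.center (GL (Fin n) F)) = xiBound hϖ g :=
  xiBound_eq_of_coe_eq hϖ (QuotientGroup.out_eq' _)

/-- `xiBoundQuot ≥ 0`. [folklore] -/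
theorem xiBoundQuot_nonneg (q : GL (Fin n) F ⧸ Subgroup.center (GL (Fin n) F)) :
    0 ≤ xiBoundQuot hϖ q :=
  xiBound_nonneg hϖ _

/-- **`Γb` is locally constant on `GL_n(F)`** (constant on the cosets `g K`), hence continuous.
[folklore] -/
theorem continuous_xiBound : Continuous (xiBound (n := n) hϖ) := by
  refine (IsLocallyConstant.iff_exists_open _).2 (fun x => ?_) |>.continuous
  refine ⟨(fun y => x⁻¹ * y) ⁻¹' (glInt n F : Set (GL (Fin n) F)),
    (isOpen_glInt n F).preimage (continuous_const_mul x⁻¹), by simp, fun y hy => ?_⟩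
  rw [Set.mem_preimage, SetLike.mem_coe] at hy
  rw [show y = 1 * x * (x⁻¹ * y) by rw [one_mul, mul_inv_cancel_left],
    xiBound_glInt_mul_mul_glInt hϖ (Subgroup.one_mem _) hy]

/-- **`Γb` is continuous on `GL_n(F) / Z`.** [folklore] -/
theorem continuous_xiBoundQuot : Continuous (xiBoundQuot (n := n) hϖ) := by
  rw [(QuotientGroup.isQuotientMap_mk (Subgroup.center (GL (Fin n) F))).continuous_iff]
  have h : xiBoundQuot (n := n) hϖ ∘ QuotientGroup.mk = xiBound hϖ := funext fun g => xiBoundQuot_mk hϖ g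
  rw [h]
  exact continuous_xiBound hϖ

/-! ### The Cartan cover of `G / Z` -/

/-- **Normalised Cartan decomposition**: every `g ∈ GL_n(F)` (`n ≥ 1`) is `k₁ ϖ^λ k₂ · (ϖ^c 1)`
with `k₁, k₂ ∈ K`, `c ∈ ℤ` and `λ ∈ ℕⁿ` antitone with last entry `0`; hence `g Z` lies in the
translate `c̃.out K Z/Z` for some coset `c̃ ∈ K ϖ^λ K / K`, and `Γb(g) = Γb(ϖ^λ)`. [folklore] -/
theorem exists_antitone_last_eq_zero_mem (hn : 0 < n) (g : GL (Fin n) F) :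
    ∃ lam : Fin n → ℕ, Antitone lam ∧ lam ⟨n - 1, by omega⟩ = 0 ∧
      xiBound hϖ g = xiBound hϖ (piPowGL hϖ.ne_zero lam) ∧
      ∃ c ∈ (finite_orbit_piPowGL hϖ lam).toFinset,
        (g : GL (Fin n) F ⧸ Subgroup.center (GL (Fin n) F)) ∈
          (fun κ : GL (Fin n) F => ((c.out * κ : GL (Fin n) F) :
            GL (Fin n) F ⧸ Subgroup.center (GL (Fin n) F))) '' (glInt n F : Set (GL (Fin n) F)) := by
  obtain ⟨k₁, hk₁, k₂, hk₂, a, ha, hg⟩ := exists_glInt_mul_mul_eq_zpowDiagGL hϖ g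
  set last : Fin n := ⟨n - 1, by omega⟩ with hlast
  set c₀ : ℤ := a last with hc₀
  set lam : Fin n → ℕ := fun i => (a i - c₀).toNat with hlam
  have hle : ∀ i : Fin n, c₀ ≤ a i := fun i => ha (Fin.mk_le_mk.2 (by have := i.2; omega) : i ≤ last)
  have hlamZ : ∀ i, (lam i : ℤ) = a i - c₀ := fun i => Int.toNat_of_nonneg (sub_nonneg.2 (hle i))
  have hanti : Antitone lam := fun i j hij => by
    simp only [hlam]
    exact Int.toNat_le_toNat (sub_le_sub_right (ha hij) _)
  have hlast0 : lam last = 0 := by simp [hlam, hc₀]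
  -- `ϖ^a = ϖ^λ · ϖ^{c₀} 1`
  set Z : GL (Fin n) F := zpowDiagGL hϖ.ne_zero (fun _ : Fin n => c₀) with hZ
  have hZc : Z ∈ Subgroup.center (GL (Fin n) F) :=
    Subgroup.mem_center_iff.2 fun x => mul_zpowDiagGL_const_comm hϖ.ne_zero c₀ x
  have hsplit : zpowDiagGL hϖ.ne_zero a = piPowGL hϖ.ne_zero lam * Z := by
    rw [← zpowDiagGL_natCast, hZ, ← zpowDiagGL_add]
    congr 1
    funext i
    rw [Pi.add_apply, hlamZ, sub_add_cancel]
  -- `g = (k₁⁻¹ ϖ^λ k₂⁻¹) Z`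
  set y : GL (Fin n) F := k₁⁻¹ * piPowGL hϖ.ne_zero lam * k₂⁻¹ with hy
  have hgy : g = y * Z := by
    have h1 : g = k₁⁻¹ * zpowDiagGL hϖ.ne_zero a * k₂⁻¹ := by rw [← hg]; group
    rw [h1, hsplit, hy]
    have hcomm : Z * k₂⁻¹ = k₂⁻¹ * Z := (Subgroup.mem_center_iff.1 hZc k₂⁻¹).symm
    simp only [mul_assoc, hcomm]
  refine ⟨lam, hanti, hlast0, ?_, ?_⟩
  · rw [hgy, xiBound_mul_of_mem_center hϖ y hZc, hy,
      xiBound_glInt_mul_mul_glInt hϖ (Subgroup.inv_mem _ hk₁) (Subgroup.inv_mem _ hk₂)]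
  · set c : GL (Fin n) F ⧸ glInt n F := ((k₁⁻¹ * piPowGL hϖ.ne_zero lam : GL (Fin n) F) :
      GL (Fin n) F ⧸ glInt n F) with hcdef
    have hc : c ∈ (finite_orbit_piPowGL hϖ lam).toFinset := by
      rw [Set.Finite.mem_toFinset]
      exact (heckeAlgebra.coe_mem_orbit_coe_iff _ _ _).2
        ⟨k₁⁻¹, Subgroup.inv_mem _ hk₁, 1, Subgroup.one_mem _, by rw [mul_one]⟩
    obtain ⟨κ, hκ⟩ := QuotientGroup.mk_out_eq_mul (glInt n F) (k₁⁻¹ * piPowGL hϖ.ne_zero lam)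
    refine ⟨c, hc, (κ : GL (Fin n) F)⁻¹ * k₂⁻¹, Subgroup.mul_mem _ (Subgroup.inv_mem _ κ.2)
      (Subgroup.inv_mem _ hk₂), ?_⟩
    dsimp only
    rw [hcdef, hκ, hgy, QuotientGroup.mk_mul_of_mem _ hZc, hy]
    congr 1
    group

section Measure

variable [MeasurableSpace (GL (Fin n) F ⧸ Subgroup.center (GL (Fin n) F))]
  [BorelSpace (GL (Fin n) F ⧸ Subgroup.center (GL (Fin n) F))]
  (μ : Measure (GL (Fin n) F ⧸ Subgroup.center (GL (Fin n) F))) [μ.IsHaarMeasure]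

/-- The union `S_λ` of the translates `c̃ K Z/Z`, `c̃ ∈ K ϖ^λ K / K`, is measurable and has
measure `≤ #(K ϖ^λ K/K) · μ(K Z/Z)`. [folklore] -/
theorem measure_biUnion_orbit_le (lam : Fin n → ℕ) :
    MeasurableSet (⋃ c ∈ (finite_orbit_piPowGL hϖ lam).toFinset,
      (fun κ : GL (Fin n) F => ((c.out * κ : GL (Fin n) F) :
        GL (Fin n) F ⧸ Subgroup.center (GL (Fin n) F))) '' (glInt n F : Set (GL (Fin n) F))) ∧
    μ (⋃ c ∈ (finite_orbit_piPowGL hϖ lam).toFinset,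
      (fun κ : GL (Fin n) F => ((c.out * κ : GL (Fin n) F) :
        GL (Fin n) F ⧸ Subgroup.center (GL (Fin n) F))) '' (glInt n F : Set (GL (Fin n) F))) ≤
      (finite_orbit_piPowGL hϖ lam).toFinset.card *
        μ ((QuotientGroup.mk : GL (Fin n) F → GL (Fin n) F ⧸ Subgroup.center (GL (Fin n) F)) ''
          (glInt n F : Set (GL (Fin n) F))) := by
  refine ⟨Finset.measurableSet_biUnion _ fun c _ => (isOpen_image_coe_mul_glInt c.out).measurableSet, ?_⟩
  refine (measure_biUnion_finset_le _ _).trans (le_of_eq ?_)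
  rw [Finset.sum_congr rfl fun c _ => show μ ((fun κ : GL (Fin n) F => ((c.out * κ : GL (Fin n) F) :
      GL (Fin n) F ⧸ Subgroup.center (GL (Fin n) F))) '' (glInt n F : Set (GL (Fin n) F))) =
      μ ((QuotientGroup.mk : GL (Fin n) F → GL (Fin n) F ⧸ Subgroup.center (GL (Fin n) F)) ''
        (glInt n F : Set (GL (Fin n) F))) by rw [image_coe_mul_glInt_eq_smul, measure_smul],
    Finset.sum_const, nsmul_eq_mul]

end Measure

/-! ### Combinatorics of the exponents -/

omit [TopologicalSpace F] [IsNonarchimedeanLocalField F] in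
/-- `2⟨ρ, m⟩ ≥ 0` for `m` antitone. [folklore] -/
theorem twoRho_nonneg_of_antitone : ∀ {d : ℕ} {m : Fin d → ℤ}, Antitone m → 0 ≤ twoRho m := by
  intro d
  induction d with
  | zero => intro m _; simp [twoRho]
  | succ d ih =>
    intro m hm
    rw [← Fin.snoc_init_self m, twoRho_snoc]
    have hinit : Antitone (Fin.init m) := fun i j hij => hm (Fin.castSucc_le_castSucc_iff.2 hij)
    have h1 := ih hinit
    have h2 : ∀ i : Fin d, m (Fin.last d) ≤ Fin.init m i := fun i => hm (Fin.castSucc_lt_last i).le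
    have h3 : (d : ℤ) * m (Fin.last d) ≤ ∑ i : Fin d, Fin.init m i := by
      calc (d : ℤ) * m (Fin.last d) = ∑ _i : Fin d, m (Fin.last d) := by
            rw [Finset.sum_const, Finset.card_univ, Fintype.card_fin, nsmul_eq_mul]
        _ ≤ _ := Finset.sum_le_sum fun i _ => h2 i
    linarith

omit [TopologicalSpace F] [IsNonarchimedeanLocalField F] in
/-- **`2⟨ρ, λ⟩ ≥ |λ|`** for `λ` antitone with last entry `0`. [folklore] -/
theorem sum_le_twoRho_of_antitone_of_last_eq_zero {d : ℕ} {m : Fin (d + 1) → ℤ} (hm : Antitone m)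
    (hlast : m (Fin.last d) = 0) : ∑ i, m i ≤ twoRho m := by
  rw [← Fin.snoc_init_self m, twoRho_snoc, hlast]
  have hinit : Antitone (Fin.init m) := fun i j hij => hm (Fin.castSucc_le_castSucc_iff.2 hij)
  have h1 := twoRho_nonneg_of_antitone hinit
  rw [Fin.sum_univ_castSucc]
  simp only [Fin.snoc_castSucc, Fin.snoc_last, mul_zero, sub_zero]
  have : ∑ i : Fin d, Fin.init m i = ∑ i : Fin d, (Fin.snoc (Fin.init m) (0 : ℤ) : Fin (d + 1) → ℤ) i.castSucc := by
    simp only [Fin.snoc_castSucc]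
  linarith

omit [TopologicalSpace F] [IsNonarchimedeanLocalField F] in
/-- `1 + ∑ a_i ≤ ∏ (1 + a_i)` for naturals (as reals). [folklore] -/
theorem one_add_sum_le_prod_one_add {ι : Type*} (s : Finset ι) (a : ι → ℕ) :
    (1 : ℝ) + ∑ i ∈ s, (a i : ℝ) ≤ ∏ i ∈ s, (1 + (a i : ℝ)) := by
  classical
  induction s using Finset.induction_on with
  | empty => simp
  | insert i s hi ih =>
    rw [Finset.sum_insert hi, Finset.prod_insert hi]
    have h0 : (0 : ℝ) ≤ a i := Nat.cast_nonneg _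
    have h1 : (1 : ℝ) ≤ ∏ j ∈ s, (1 + (a j : ℝ)) :=
      Finset.prod_induction _ (fun x : ℝ => 1 ≤ x) (fun x y hx hy => one_le_mul_of_one_le_of_one_le hx hy)
        le_rfl fun j _ => by linarith [(Nat.cast_nonneg (a j) : (0 : ℝ) ≤ a j)]
    nlinarith

/-- **Product formula for sums over `ℕᵈ`** (in `ℝ≥0∞`): `∑_{a ∈ ℕᵈ} ∏_i h(a_i) = (∑_m h(m))ᵈ`.
[folklore] -/
theorem ENNReal.tsum_pi_fin_prod (h : ℕ → ℝ≥0∞) :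
    ∀ d : ℕ, ∑' a : Fin d → ℕ, ∏ i, h (a i) = (∑' m, h m) ^ d := by
  intro d
  induction d with
  | zero =>
    rw [pow_zero, tsum_eq_single (fun i => Fin.elim0 i) fun b hb =>
      absurd (Subsingleton.elim b _) hb]
    simp
  | succ d ih =>
    have hcons : ∀ p : ℕ × (Fin d → ℕ),
        ∏ i, h ((Fin.consEquiv (fun _ : Fin (d + 1) => ℕ) p) i) = h p.1 * ∏ i, h (p.2 i) := by
      intro p
      rw [Fin.prod_univ_succ]
      rfl
    rw [← (Fin.consEquiv fun _ : Fin (d + 1) => ℕ).tsum_eq, ENNReal.tsum_prod']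
    simp only [hcons, ENNReal.tsum_mul_left, ih]
    rw [ENNReal.tsum_mul_right, pow_succ, mul_comm]

omit [TopologicalSpace F] [IsNonarchimedeanLocalField F] in
/-- **Summability of `(m+1)^a r^m`** for `0 ≤ r < 1` and a real exponent `a`. [folklore] -/
theorem summable_succ_rpow_mul_pow {a r : ℝ} (hr0 : 0 ≤ r) (hr1 : r < 1) :
    Summable fun m : ℕ => ((m : ℝ) + 1) ^ a * r ^ m := by
  -- compare with `(m+1)^k r^m`, `k = ⌈a⌉₊`
  set k : ℕ := ⌈a⌉₊ with hk
  have hkey : Summable fun m : ℕ => ((m : ℝ) + 1) ^ k * r ^ m := by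
    have h := summable_pow_mul_geometric_of_norm_lt_one k (show ‖r‖ < 1 by
      rw [Real.norm_of_nonneg hr0]; exact hr1)
    have h' := (summable_nat_add_iff 1).2 h
    rcases eq_or_lt_of_le hr0 with hr | hr
    · subst hr
      refine summable_of_ne_finset_zero (s := {0}) fun m hm => ?_
      rw [Finset.mem_singleton] at hm
      simp [zero_pow hm]
    · have := h'.mul_left r⁻¹
      refine this.congr fun m => ?_
      push_cast
      rw [pow_succ]
      field_simp
  refine Summable.of_nonneg_of_le (fun m => by positivity) (fun m => ?_) hkey
  refine mul_le_mul_of_nonneg_right ?_ (pow_nonneg hr0 _)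
  calc ((m : ℝ) + 1) ^ a ≤ ((m : ℝ) + 1) ^ (k : ℝ) :=
        Real.rpow_le_rpow_of_exponent_le (by simp) (Nat.le_ceil a)
    _ = ((m : ℝ) + 1) ^ k := Real.rpow_natCast _ _

/-! ### The `L^p` bound for `Γb` -/

section MemLp

variable [MeasurableSpace (GL (Fin n) F ⧸ Subgroup.center (GL (Fin n) F))]
  [BorelSpace (GL (Fin n) F ⧸ Subgroup.center (GL (Fin n) F))]
  (μ : Measure (GL (Fin n) F ⧸ Subgroup.center (GL (Fin n) F))) [μ.IsHaarMeasure]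

/-- **The per-shape bound**: for `λ` antitone with last entry `0` and `P > 2`,
`#(Kϖ^λK/K) · Γb(ϖ^λ)^P ≤ (|λ|+1)^{n² P} (Q^{2-P})^{|λ|}`
(Harish-Chandra estimate `xiSum_piPowGL_le`, degree bound `sqrtResidueCard_zpow_le_card_orbit`,
and `2⟨ρ, λ⟩ ≥ |λ|`). [folklore] -/
theorem card_mul_xiBound_rpow_le {lam : Fin n → ℕ} (hanti : Antitone lam)
    (hlast : ∀ h : 0 < n, lam ⟨n - 1, by omega⟩ = 0) {P : ℝ} (hP : 2 < P) :
    ((finite_orbit_piPowGL hϖ lam).toFinset.card : ℝ) * xiBound hϖ (piPowGL hϖ.ne_zero lam) ^ P ≤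
      ((∑ i, lam i : ℕ) + 1 : ℝ) ^ ((n : ℝ) * n * P) *
        (sqrtResidueCard F ^ (2 - P)) ^ ((∑ i, lam i : ℕ) : ℝ) := by
  set Q := sqrtResidueCard F with hQdef
  have hQ1 : 1 < Q := one_lt_sqrtResidueCard
  have hQ : 0 < Q := one_pos.trans hQ1
  set tw : ℤ := twoRho (fun i => (lam i : ℤ)) with htw
  set m : ℕ := ∑ i, lam i with hm
  set deg : ℝ := ((finite_orbit_piPowGL hϖ lam).toFinset.card : ℝ) with hdeg
  -- the two inputs
  have hxi : xiSum hϖ Q (piPowGL hϖ.ne_zero lam) ≤ ((m : ℝ) + 1) ^ (n * n) * Q ^ tw := by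
    have := xiSum_piPowGL_le hϖ n lam hanti
    rw [← hQdef] at this
    exact_mod_cast this
  have hdegle : Q ^ (2 * tw) ≤ deg := by
    have h := sqrtResidueCard_zpow_le_card_orbit hϖ lam
    rw [hdeg]
    convert h using 2
  have hdegpos : 0 < deg := lt_of_lt_of_le (zpow_pos hQ _) hdegle
  -- `2⟨ρ, λ⟩ ≥ |λ|`
  have htwm : (m : ℤ) ≤ tw := by
    rcases Nat.eq_zero_or_pos n with hn | hn
    · subst hn
      simp [hm, htw, twoRho]
    · obtain ⟨d, rfl⟩ : ∃ d, n = d + 1 := ⟨n - 1, by omega⟩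
      have h := sum_le_twoRho_of_antitone_of_last_eq_zero (m := fun i => (lam i : ℤ))
        (fun i j hij => by dsimp only; exact_mod_cast hanti hij) (by
          have := hlast hn
          simp only [Nat.add_sub_cancel] at this
          exact_mod_cast this)
      rw [hm]
      push_cast
      exact h
  -- `deg · (xiSum/deg)^P = xiSum^P · deg^{1-P} ≤ (poly Q^tw)^P (Q^{2tw})^{1-P}`
  have hxi0 : 0 ≤ xiSum hϖ Q (piPowGL hϖ.ne_zero lam) := xiSum_nonneg hϖ hQ.le _
  rw [xiBound, ← hdeg, ← hQdef, Real.div_rpow hxi0 hdegpos.le]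
  have hP0 : 0 < P := by linarith
  have e1 : deg * (xiSum hϖ Q (piPowGL hϖ.ne_zero lam) ^ P / deg ^ P) =
      xiSum hϖ Q (piPowGL hϖ.ne_zero lam) ^ P * deg ^ (1 - P) := by
    rw [Real.rpow_sub hdegpos, Real.rpow_one]
    ring
  rw [e1]
  have h1 : xiSum hϖ Q (piPowGL hϖ.ne_zero lam) ^ P ≤ (((m : ℝ) + 1) ^ (n * n) * Q ^ tw) ^ P :=
    Real.rpow_le_rpow hxi0 hxi (by linarith)
  have h2 : deg ^ (1 - P) ≤ (Q ^ (2 * tw)) ^ (1 - P) :=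
    Real.rpow_le_rpow_of_nonpos (zpow_pos hQ _) hdegle (by linarith)
  refine (mul_le_mul h1 h2 (Real.rpow_nonneg hdegpos.le _)
    (Real.rpow_nonneg (mul_nonneg (by positivity) (zpow_nonneg hQ.le _)) _)).trans ?_
  -- exponent arithmetic
  have hm1 : (1 : ℝ) ≤ (m : ℝ) + 1 := by simp
  rw [Real.mul_rpow (by positivity) (zpow_nonneg hQ.le _), ← Real.rpow_natCast,
    ← Real.rpow_mul (by positivity), ← Real.rpow_intCast Q tw, ← Real.rpow_mul hQ.le,
    ← Real.rpow_intCast Q (2 * tw), ← Real.rpow_mul hQ.le, mul_assoc, ← Real.rpow_add hQ,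
    ← Real.rpow_mul hQ.le]
  push_cast
  refine mul_le_mul (le_of_eq (by ring_nf)) ?_ (by positivity) (by positivity)
  refine Real.rpow_le_rpow_of_exponent_le hQ1.le ?_
  have htwm' : (m : ℝ) ≤ (tw : ℝ) := by exact_mod_cast htwm
  nlinarith

/-- **`C · Γb ∈ L^P(G/Z)` for `P > 2`** (`n ≥ 1`): continuity gives measurability, and by the
Cartan cover `∫ Γb^P ≤ μ(KZ/Z) ∑_{λ} #(Kϖ^λK/K) Γb(ϖ^λ)^P ≤ μ(KZ/Z) ∑_λ (|λ|+1)^{n²P} (Q^{2-P})^{|λ|}`,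
which is finite (`(Q^{2-P})^{|λ|} (|λ|+1)^{a} ≤ ∏_i (λ_i + 1)^a (Q^{2-P})^{λ_i}` and the product
formula). [folklore] -/
theorem memLp_const_mul_xiBoundQuot (hn : 0 < n) {C : ℝ} (hC : 0 ≤ C) {P : ℝ} (hP : 2 < P) :
    MemLp (fun q => C * xiBoundQuot hϖ q) (ENNReal.ofReal P) μ := by
  have hP0 : 0 < P := by linarith
  set Q := sqrtResidueCard F with hQdef
  have hQ1 : 1 < Q := one_lt_sqrtResidueCard
  have hQ : 0 < Q := one_pos.trans hQ1
  -- measurability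
  have hcont : Continuous fun q : GL (Fin n) F ⧸ Subgroup.center (GL (Fin n) F) =>
      C * xiBoundQuot hϖ q := continuous_const.mul (continuous_xiBoundQuot hϖ)
  refine ⟨hcont.aestronglyMeasurable, ?_⟩
  rw [eLpNorm_lt_top_iff_lintegral_rpow_enorm_lt_top (by positivity) ENNReal.ofReal_ne_top,
    ENNReal.toReal_ofReal hP0.le]
  -- the sets `S_λ` and the values on them
  set 𝒦 := (QuotientGroup.mk : GL (Fin n) F → GL (Fin n) F ⧸ Subgroup.center (GL (Fin n) F)) ''
    (glInt n F : Set (GL (Fin n) F)) with h𝒦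
  have hμ𝒦 : μ 𝒦 < ∞ := (isCompact_image_coe_glInt (n := n) (F := F)).measure_lt_top
  set S : (Fin n → ℕ) → Set (GL (Fin n) F ⧸ Subgroup.center (GL (Fin n) F)) := fun lam =>
    ⋃ c ∈ (finite_orbit_piPowGL hϖ lam).toFinset,
      (fun κ : GL (Fin n) F => ((c.out * κ : GL (Fin n) F) :
        GL (Fin n) F ⧸ Subgroup.center (GL (Fin n) F))) '' (glInt n F : Set (GL (Fin n) F)) with hS
  have hSm : ∀ lam, MeasurableSet (S lam) := fun lam => (measure_biUnion_orbit_le hϖ μ lam).1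
  have hSμ : ∀ lam, μ (S lam) ≤ (finite_orbit_piPowGL hϖ lam).toFinset.card * μ 𝒦 :=
    fun lam => (measure_biUnion_orbit_le hϖ μ lam).2
  classical
  set good : (Fin n → ℕ) → Prop := fun lam => Antitone lam ∧ lam ⟨n - 1, by omega⟩ = 0 with hgood
  set val : (Fin n → ℕ) → ℝ≥0∞ := fun lam =>
    if good lam then ENNReal.ofReal ((C * xiBound hϖ (piPowGL hϖ.ne_zero lam)) ^ P) else 0 with hval
  -- pointwise domination by the series of indicators
  have hpt : ∀ q, ‖C * xiBoundQuot hϖ q‖ₑ ^ P ≤ ∑' lam, (S lam).indicator (fun _ => val lam) q := by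
    intro q
    induction q using QuotientGroup.induction_on with
    | H g =>
      obtain ⟨lam, hanti, hl0, hb, c, hc, hmem⟩ := exists_antitone_last_eq_zero_mem hϖ hn g
      have hq : (g : GL (Fin n) F ⧸ Subgroup.center (GL (Fin n) F)) ∈ S lam :=
        Set.mem_biUnion (Finset.mem_coe.2 hc) hmem
      refine le_trans (le_of_eq ?_) (ENNReal.le_tsum lam)
      rw [Set.indicator_of_mem hq]
      simp only [hval]
      rw [if_pos (⟨hanti, hl0⟩ : good lam), xiBoundQuot_mk, hb,
        Real.enorm_eq_ofReal (mul_nonneg hC (xiBound_nonneg hϖ _)),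
        ENNReal.ofReal_rpow_of_nonneg (mul_nonneg hC (xiBound_nonneg hϖ _)) hP0.le]
  -- integrate
  have hint : ∫⁻ q, ‖C * xiBoundQuot hϖ q‖ₑ ^ P ∂μ ≤ ∑' lam, val lam * μ (S lam) := by
    calc ∫⁻ q, ‖C * xiBoundQuot hϖ q‖ₑ ^ P ∂μ
        ≤ ∫⁻ q, ∑' lam, (S lam).indicator (fun _ => val lam) q ∂μ := lintegral_mono hpt
      _ = ∑' lam, ∫⁻ q, (S lam).indicator (fun _ => val lam) q ∂μ :=
          lintegral_tsum fun lam => (measurable_const.indicator (hSm lam)).aemeasurable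
      _ = ∑' lam, val lam * μ (S lam) := by
          congr 1
          funext lam
          rw [lintegral_indicator_const (hSm lam)]
  refine lt_of_le_of_lt hint ?_
  -- the real bound per shape
  set r : ℝ := Q ^ (2 - P) with hr
  have hr0 : 0 < r := Real.rpow_pos_of_pos hQ _
  have hr1 : r < 1 := Real.rpow_lt_one_of_one_lt_of_neg hQ1 (by linarith)
  set a : ℝ := (n : ℝ) * n * P with ha
  have ha0 : 0 ≤ a := by positivity
  set hh : ℕ → ℝ := fun k => ((k : ℝ) + 1) ^ a * r ^ k with hhh
  have hhh0 : ∀ k, 0 ≤ hh k := fun k => by positivity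
  have hterm : ∀ lam, val lam * μ (S lam) ≤
      μ 𝒦 * ENNReal.ofReal (C ^ P) * ∏ i, ENNReal.ofReal (hh (lam i)) := by
    intro lam
    by_cases hg : good lam
    · simp only [hval, if_pos hg]
      have h1 := card_mul_xiBound_rpow_le hϖ hg.1 (fun _ => hg.2) hP
      calc ENNReal.ofReal ((C * xiBound hϖ (piPowGL hϖ.ne_zero lam)) ^ P) * μ (S lam)
          ≤ ENNReal.ofReal ((C * xiBound hϖ (piPowGL hϖ.ne_zero lam)) ^ P) *
              ((finite_orbit_piPowGL hϖ lam).toFinset.card * μ 𝒦) := mul_le_mul' le_rfl (hSμ lam)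
        _ = μ 𝒦 * ENNReal.ofReal (C ^ P) * ENNReal.ofReal
              (((finite_orbit_piPowGL hϖ lam).toFinset.card : ℝ) *
                xiBound hϖ (piPowGL hϖ.ne_zero lam) ^ P) := by
            rw [Real.mul_rpow hC (xiBound_nonneg hϖ _), ENNReal.ofReal_mul (Real.rpow_nonneg hC _),
              ENNReal.ofReal_mul (Nat.cast_nonneg _), ENNReal.ofReal_natCast]
            ring
        _ ≤ μ 𝒦 * ENNReal.ofReal (C ^ P) * ENNReal.ofReal
              ((((∑ i, lam i : ℕ) : ℝ) + 1) ^ a * r ^ ((∑ i, lam i : ℕ) : ℝ)) :=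
            mul_le_mul' le_rfl (ENNReal.ofReal_le_ofReal h1)
        _ ≤ μ 𝒦 * ENNReal.ofReal (C ^ P) * ∏ i, ENNReal.ofReal (hh (lam i)) := by
            refine mul_le_mul' le_rfl ?_
            rw [← ENNReal.ofReal_prod_of_nonneg fun i _ => hhh0 (lam i)]
            refine ENNReal.ofReal_le_ofReal ?_
            simp only [hhh]
            rw [Finset.prod_mul_distrib, Real.rpow_natCast, Finset.prod_pow_eq_pow_sum]
            refine mul_le_mul_of_nonneg_right ?_ (pow_nonneg hr0.le _)
            refine le_trans (Real.rpow_le_rpow (by positivity) ?_ ha0)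
              (le_of_eq (Real.finsetProd_rpow Finset.univ (fun i => (lam i : ℝ) + 1)
                (fun i _ => by positivity) a).symm)
            have := one_add_sum_le_prod_one_add (Finset.univ : Finset (Fin n)) lam
            push_cast at this ⊢
            calc (∑ i, (lam i : ℝ)) + 1 = 1 + ∑ i, (lam i : ℝ) := add_comm _ _
              _ ≤ ∏ i, (1 + (lam i : ℝ)) := this
              _ = ∏ i, ((lam i : ℝ) + 1) := Finset.prod_congr rfl fun i _ => add_comm _ _
    · simp only [hval, if_neg hg, zero_mul]
      exact bot_le
  calc ∑' lam, val lam * μ (S lam)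
      ≤ ∑' lam : Fin n → ℕ, μ 𝒦 * ENNReal.ofReal (C ^ P) * ∏ i, ENNReal.ofReal (hh (lam i)) :=
        ENNReal.tsum_le_tsum hterm
    _ = μ 𝒦 * ENNReal.ofReal (C ^ P) * (∑' k, ENNReal.ofReal (hh k)) ^ n := by
        rw [ENNReal.tsum_mul_left, ENNReal.tsum_pi_fin_prod (fun k => ENNReal.ofReal (hh k)) n]
    _ < ∞ := by
        refine ENNReal.mul_lt_top (ENNReal.mul_lt_top hμ𝒦 ENNReal.ofReal_lt_top) (ENNReal.pow_lt_top ?_)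
        rw [← ENNReal.ofReal_tsum_of_nonneg hhh0 (summable_succ_rpow_mul_pow hr0.le hr1)]
        exact ENNReal.ofReal_lt_top

end MemLp

/-! ### The theorem -/

open GaloisRepresentations.IsNonarchimedeanLocalField in
/-- **Unitary Satake parameters ⇒ tempered** (the direction `←` of the named fact
`isTempered_iff_forall_norm_eq_one`; Macdonald (1971), Cartier, Corvallis (1979), §IV.5,
Getz–Hahn (2024), Exercise 8.11): an irreducible admissible representation of `GL_n(F)` whose
Satake parameters all have complex norm `1` is tempered — every smooth matrix coefficient is
dominated by a multiple of the continuous function `Γb = Ξ-sum/deg ∈ ⋂_{p>2} L^p(G/Z)` (see the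
module docstring). [cite: CartierCorvallis1979, §IV.5] -/
theorem isTempered_of_forall_norm_eq_one
    [MeasurableSpace (GL (Fin n) F ⧸ Subgroup.center (GL (Fin n) F))]
    [BorelSpace (GL (Fin n) F ⧸ Subgroup.center (GL (Fin n) F))]
    (μ : Measure (GL (Fin n) F ⧸ Subgroup.center (GL (Fin n) F))) [μ.IsHaarMeasure]
    [ρ.IsIrreducible] (hadm : ρ.IsAdmissible) {ϖ : Fˣ} (hϖ : (valuation F).IsUniformizer (ϖ : F))
    {α : Multiset ℂ} (hα : IsSatakeParameter ρ ϖ α) (hunit : ∀ a ∈ α, ‖a‖ = 1) :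
    ρ.IsTempered μ := by
  -- `n = 0` is covered by the rank `≤ 1` case
  rcases Nat.eq_zero_or_pos n with hn | hn
  · exact (isTempered_iff_forall_norm_eq_one_of_le_one ρ (by omega) μ hadm hϖ hα).2 hunit
  obtain ⟨hcard, v, hv, hv0, hT⟩ := id hα
  -- the uniformizer as a uniformizing element
  have hϖ' : IsUniformizingElement (ϖ : F) := by
    have hmem : (ϖ : F) ∈ 𝒪[F] := (Valuation.mem_integer_iff _ _).2 hϖ.val_lt_one.le
    exact ⟨hmem, hϖ.ne_zero,
      Valuation.IsUniformizer.is_generator (v := valuation F) (π := ⟨(ϖ : F), hmem⟩) hϖ⟩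
  have h0 : ∀ a ∈ α, a ≠ 0 := fun a ha ha0 => by
    have := hunit a ha; rw [ha0, norm_zero] at this; exact zero_ne_one this
  -- the Satake point `z = q^{(n-1)/2} α`
  have hϖu : Units.mk0 (ϖ : F) hϖ'.ne_zero = ϖ := Units.ext rfl
  have hT' : ∀ i ≤ n, heckeT ρ ϖ i v =
      (((Real.sqrt (Nat.card 𝓀[F]) ^ (i * (n - i)) : ℝ) : ℂ) * α.esymm i) • v := by
    intro i hi; rw [hT i hi]; rfl
  obtain ⟨z, hzα, hTz⟩ := exists_units_heckeOperator_apply_eq_of_heckeT ρ hϖ' hcard h0 hT'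
  have hz : ∀ i, ‖(z i : ℂ)‖ = sqrtResidueCard F ^ (n - 1) := by
    intro i
    rw [norm_eq_of_univ_val_map_eq hzα hunit i, norm_pow, Complex.norm_real,
      Real.norm_of_nonneg (Real.sqrt_nonneg _)]
    rfl
  -- the centre `ϖ · 1` acts by `∏ α`, of norm `1`
  have hPv : ρ (heckeDiag n (Units.mk0 (ϖ : F) hϖ'.ne_zero) n) v = α.prod • v := by
    rw [hϖu, ← heckeT_self_apply ρ ϖ hv, hT n le_rfl, Nat.sub_self, mul_zero, pow_zero,
      Complex.ofReal_one, one_mul, ← hcard, multisetEsymm_card_eq_prod]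
  have hP : ‖α.prod‖ = 1 := norm_multiset_prod_eq_one hunit
  -- a smooth `K`-invariant form `φ₀` with `φ₀ v ≠ 0`
  obtain ⟨φ₀, hφ₀c, hφ₀K, hφ₀v⟩ := hadm.isSmooth.exists_mem_contragredient_apply_ne_zero_of_mem_fixedPoints
    (isOpen_glInt n F) (isCompact_glInt n F) hv hv0
  have hφ₀inv : ∀ k ∈ glInt n F, ∀ w : V, φ₀ (ρ k w) = φ₀ w := by
    intro k hk w
    have h := LinearMap.congr_fun (hφ₀K k⁻¹ (Subgroup.inv_mem _ hk)) w
    rw [Representation.dual_apply, inv_inv, Module.Dual.transpose_apply, LinearMap.comp_apply] at h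
    exact h
  -- the zonal bound and the bound for all coefficients
  have hzonal := norm_apply_le_mul_xiBound hϖ' ρ hφ₀inv hv hTz hz hP hPv
  intro ε hε φ hφ w
  obtain ⟨C, hC0, hC⟩ := exists_norm_matrixCoeff_le_mul_xiBound hϖ' ρ hadm hφ₀c hv0 hzonal hφ₀v hφ w
  refine ⟨fun q => C * xiBoundQuot hϖ' q, memLp_const_mul_xiBoundQuot hϖ' μ hn hC0 (by linarith),
    fun g => ?_⟩
  dsimp only
  rw [xiBoundQuot_mk]
  exact hC g

/-- **Discharge of the named fact** `isTempered_iff_forall_norm_eq_one` (tempered ⇔ unitary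
Satake parameters for irreducible admissible unramified representations of `GL_n(F)`;
Macdonald (1971); Cartier, Corvallis (1979), §IV.5; Borel, Corvallis (1979), §10.4; Getz–Hahn
(2024), Exercise 8.11): `→` is `forall_norm_eq_one_of_isTempered`
(`SatakeParametersGLTemperedProofs`), `←` is `isTempered_of_forall_norm_eq_one`.
[cite: CartierCorvallis1979, §IV.5] -/
theorem isTempered_iff_forall_norm_eq_one_holds : isTempered_iff_forall_norm_eq_one ρ := by
  refine isTempered_iff_forall_norm_eq_one_of_converse ρ ?_
  intro _ _ μ _ _ hadm ϖ hϖ α hα hunit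
  exact isTempered_of_forall_norm_eq_one ρ μ hadm hϖ hα hunit

end LocalField

end Literature.NumberTheory.Automorphic
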